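import Summits.AtomisticToContinuum.FouriersLaw.Theorems.HonestZwanzigRobinCoercivityStubBlockForm
import Summits.AtomisticToContinuum.FouriersLaw.Theorems.HonestZwanzigRobinCoercivitySymbolLowerBoundToeplitz

/-!
# `HonestZwanzig.RobinCoercivity`, line `limit-operator-memory-form`: the crux bounds every bulk symbol from below
(part 2 of 2, the chain)

Support file for the crux `stmt-AtomisticToContinuum-12695` (`RobinCoercivity` of route `HonestZwanzig`, sub-problem
`FouriersLaw`), line `limit-operator-memory-form`, registered NECESSITY link `symbol_ge_of_robinCoercivity`: if the crux
`RobinCoercivity` holds with constant `c`, then every summable `K : ℤ → ℝ` that is a bulk Toeplitz limit of the block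
memory matrix `W_N(s)` (the bulk-limit property (L) of the line, verbatim the hypothesis of the registered stub
`stub_symbolPositivity`, rev 2) has cosine symbol `Σ'_z K(z)cos(zθ) ≥ c` at EVERY `θ`. So, given (L), the line's open
stub (Q1) "bulk symbol positivity" is necessary for the crux (and a zero of the symbol of a bulk limit refutes it).

Proof.
* Lemma A (`Bv_profile`): a vector `v` supported on a bulk window of bond positions with `Σ_i v_i = 0` is the Robin
  incidence `Bξ` of its partial-sum profile `ξ_x = Σ_{i ≤ x} v_i` (which vanishes outside the window).
* Step 1 (`window_fixedN`, one fixed `N`): by the block form (`Robin.stub_blockForm`)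
  `c|v|² = c·Robin(ξ) ≤ ξᵀ𝔽_N(s)ξ = s·ξᵀCov(e,e)ξ + vᵀW_N(s)v`, and `vᵀW_N(s)v ≤ vᵀT(K)v + ε(Σ|v_i|)²` by the entrywise
  bulk comparison; letting `s ↓ 0` kills the static term. With `ε ↓ 0` (choosing `R`, then `N = 2R+2+M`):
  every Toeplitz section of `K` is `≥ c` on mean-zero vectors.
* Step 2 (part 1, `symbol_ge_of_meanZero_coercive`): mean-zero coercivity of all sections is full coercivity (dipole
  test vectors `(u, 0_D, −u)`, `D → ∞`), and full coercivity gives `K̂ ≥ c` (Fejér/Cesàro with the cosine and sine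
  profiles).
-/

noncomputable section

open MeasureTheory Finset Matrix Filter Topology
open Literature.MathematicalPhysics.KineticTheory.HeatConduction
open Summit.AtomisticToContinuum.FouriersLaw.Theses.HonestZwanzig

namespace Summit.AtomisticToContinuum.FouriersLaw.Theorems.HonestZwanzig.Robin

/-! ### Lemma A: a mean-zero window vector is the Robin incidence of its partial-sum profile -/

section Profile

variable {N : ℕ} (Bv : (Fin N → ℝ) → Fin (N + 1) → ℝ)
  (hBv : ∀ ξ i, Bv ξ i = if i.val = N then (∑ x : Fin N, if x.val + 1 = N then ξ x else 0)
    else ∑ x : Fin N, ((if x.val = i.val then ξ x else 0) - (if x.val + 1 = i.val then ξ x else 0)))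
include hBv

/-- **Lemma A.** For `u_0, …, u_{M−1}` with `Σ_k u_k = 0`, placed on the window of positions `A, …, A+M−1`
(`1 ≤ A`, `A + M ≤ N`), the partial-sum profile `ξ_x = Σ_{k < min(x+1−A, M)} u_k` on the sites has Robin incidence
`(Bξ)_i = u_{i−A}` on the window and `0` elsewhere. -/
theorem Bv_profile (hN : 1 ≤ N) {A M : ℕ} (hA : 1 ≤ A) (hAM : A + M ≤ N) (u : ℕ → ℝ)
    (hu : ∑ k ∈ range M, u k = 0) (i : Fin (N + 1)) :
    Bv (fun x : Fin N => ∑ k ∈ range (min (x.val + 1 - A) M), u k) i =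
      if A ≤ i.val ∧ i.val < A + M then u (i.val - A) else 0 := by
  have hstep : ∀ n : ℕ, (∑ k ∈ range (min (n + 1 + 1 - A) M), u k) - ∑ k ∈ range (min (n + 1 - A) M), u k =
      if A ≤ n + 1 ∧ n + 1 < A + M then u (n + 1 - A) else 0 := by
    intro n
    by_cases h1 : A ≤ n + 1 ∧ n + 1 < A + M
    · rw [if_pos h1]
      have e1 : min (n + 1 + 1 - A) M = (n + 1 - A) + 1 := by omega
      have e2 : min (n + 1 - A) M = n + 1 - A := by omega
      rw [e1, e2, Finset.sum_range_succ]
      ring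
    · rw [if_neg h1]
      have e1 : min (n + 1 + 1 - A) M = min (n + 1 - A) M := by omega
      rw [e1, sub_self]
  rcases Fin.eq_zero_or_eq_succ i with rfl | ⟨b, rfl⟩
  · rw [blockForm_Bv_zero Bv hBv hN, Fin.val_zero, if_neg (by omega)]
    have e1 : min (0 + 1 - A) M = 0 := by omega
    show ∑ k ∈ range (min (0 + 1 - A) M), u k = 0
    rw [e1, Finset.sum_range_zero]
  · by_cases hb : b.val + 1 < N
    · rw [blockForm_Bv_succ Bv hBv _ b hb, Fin.val_succ]
      exact hstep b.val
    · have hb' : b.val + 1 = N := by omega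
      rw [blockForm_Bv_succ_last Bv hBv _ b hb', Fin.val_succ, if_neg (by omega)]
      have e1 : min (b.val + 1 - A) M = M := by omega
      show ∑ k ∈ range (min (b.val + 1 - A) M), u k = 0
      rw [e1, hu]

end Profile

/-! ### Step 1 at one fixed `N`: bulk window sections of a bulk limit are `c`-coercive on mean-zero vectors -/

/-- **Window coercivity at fixed `N`** (abstract gadgets of the route with their defining equations, as in
`Robin.stub_blockForm`). If `c·Robin(ξ) ≤ ξᵀ𝔽_N(s)ξ` for `0 < s < s₁` (the crux's clause at this `N`) and the bond
block of `W_N(s)` is entrywise `ε`-close to the Toeplitz matrix of `K` on the bulk positions at depth `R` and mutual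
distance `≤ Z` for `0 < s < s₀` (the bulk-limit clause at this `N`), then for every window length `M ≤ Z` with
`2R + 2 + M ≤ N` and every `u_0, …, u_{M−1}` with `Σ_k u_k = 0`:
`c Σ_k u_k² ≤ Σ_{k,l} u_k K(k−l) u_l + ε (Σ_k |u_k|)²`. -/
theorem window_fixedN {ω₂ lam β γ T : ℝ} (hω : 0 < ω₂) (hl : 0 < lam) (hβ : 0 < β) (hγ : 0 < γ) (hT : 0 < T)
    {N : ℕ} (hN : 2 ≤ N) (K : ℤ → ℝ) (c ε s₀ s₁ : ℝ) (hs₀ : 0 < s₀) (hs₁ : 0 < s₁) (R M Z : ℕ)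
    (hRM : 2 * R + 2 + M ≤ N) (hMZ : M ≤ Z)
    (hbulk : ∀ (lap : ℝ → (PhaseSpace N → ℝ) → (PhaseSpace N → ℝ) → ℝ) (e : Fin N → PhaseSpace N → ℝ)
      (G : ℝ → Matrix (Fin N) (Fin N) ℝ) (schur : ℝ → (PhaseSpace N → ℝ) → (PhaseSpace N → ℝ) → ℝ)
      (g : Fin (N + 1) → PhaseSpace N → ℝ) (W : ℝ → Fin (N + 1) → Fin (N + 1) → ℝ),
    (∀ s f₁ f₂, lap s f₁ f₂ = ∫ t in Set.Ioi (0 : ℝ), Real.exp (-(s * t)) *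
      ((∫ z, f₁ z * (∫ y, f₂ y ∂((pinnedChain ω₂ lam β γ).transitionKernel N T T t.toNNReal z))
          ∂(pinnedChain ω₂ lam β γ).gibbsMeasure N T) -
        (∫ z, f₁ z ∂(pinnedChain ω₂ lam β γ).gibbsMeasure N T) *
          (∫ z, f₂ z ∂(pinnedChain ω₂ lam β γ).gibbsMeasure N T))) →
    (∀ x z, e x z = z.2 x ^ 2 / 2 + (pinnedChain ω₂ lam β γ).U (z.1 x) +
      ∑ j : Fin N, ((if j.val = x.val + 1 then (pinnedChain ω₂ lam β γ).V (z.1 j - z.1 x) / 2 else 0) +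
        (if x.val = j.val + 1 then (pinnedChain ω₂ lam β γ).V (z.1 x - z.1 j) / 2 else 0))) →
    (∀ s, G s = Matrix.of fun x y => lap s (e x) (e y)) →
    (∀ s f₁ f₂, schur s f₁ f₂ = lap s f₁ f₂ - ∑ x, ∑ y, lap s f₁ (e x) * (G s)⁻¹ x y * lap s (e y) f₂) →
    (∀ i z, g i z = (∑ b : Fin N, if b.val + 1 = i.val then (pinnedChain ω₂ lam β γ).bondCurrent N b z else 0) +
      (∑ x : Fin N, if (i.val = 0 ∧ x.val = 0) ∨ (i.val = N ∧ x.val + 1 = N) then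
        (pinnedChain ω₂ lam β γ).γ * (T - z.2 x ^ 2) else 0)) →
    (∀ s i j, W s i j = (if i = j ∧ (i.val = 0 ∨ i.val = N) then (pinnedChain ω₂ lam β γ).γ * T ^ 2 else 0) -
      schur s (fun z => g i (z.1, -z.2)) (g j)) →
    ∀ s : ℝ, 0 < s → s < s₀ → ∀ i j : Fin (N + 1),
      R + 1 ≤ i.val → i.val + 1 + R ≤ N → R + 1 ≤ j.val → j.val + 1 + R ≤ N →
      i.val ≤ j.val + Z → j.val ≤ i.val + Z → |W s i j - K ((i.val : ℤ) - j.val)| ≤ ε)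
    (lap : ℝ → (PhaseSpace N → ℝ) → (PhaseSpace N → ℝ) → ℝ)
    (cov : (PhaseSpace N → ℝ) → (PhaseSpace N → ℝ) → ℝ) (e : Fin N → PhaseSpace N → ℝ)
    (G : ℝ → Matrix (Fin N) (Fin N) ℝ) (schur : ℝ → (PhaseSpace N → ℝ) → (PhaseSpace N → ℝ) → ℝ)
    (F : ℝ → Fin N → Fin N → ℝ) (g : Fin (N + 1) → PhaseSpace N → ℝ)
    (W : ℝ → Fin (N + 1) → Fin (N + 1) → ℝ) (Bv : (Fin N → ℝ) → Fin (N + 1) → ℝ)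
    (hlap : ∀ s f₁ f₂, lap s f₁ f₂ = ∫ t in Set.Ioi (0 : ℝ), Real.exp (-(s * t)) *
      ((∫ z, f₁ z * (∫ y, f₂ y ∂((pinnedChain ω₂ lam β γ).transitionKernel N T T t.toNNReal z))
          ∂(pinnedChain ω₂ lam β γ).gibbsMeasure N T) -
        (∫ z, f₁ z ∂(pinnedChain ω₂ lam β γ).gibbsMeasure N T) *
          (∫ z, f₂ z ∂(pinnedChain ω₂ lam β γ).gibbsMeasure N T)))
    (hcov : ∀ f₁ f₂, cov f₁ f₂ = (∫ z, f₁ z * f₂ z ∂(pinnedChain ω₂ lam β γ).gibbsMeasure N T) -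
      (∫ z, f₁ z ∂(pinnedChain ω₂ lam β γ).gibbsMeasure N T) *
        (∫ z, f₂ z ∂(pinnedChain ω₂ lam β γ).gibbsMeasure N T))
    (he : ∀ x z, e x z = z.2 x ^ 2 / 2 + (pinnedChain ω₂ lam β γ).U (z.1 x) +
      ∑ j : Fin N, ((if j.val = x.val + 1 then (pinnedChain ω₂ lam β γ).V (z.1 j - z.1 x) / 2 else 0) +
        (if x.val = j.val + 1 then (pinnedChain ω₂ lam β γ).V (z.1 x - z.1 j) / 2 else 0)))
    (hG : ∀ s, G s = Matrix.of fun x y => lap s (e x) (e y))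
    (hschur : ∀ s f₁ f₂, schur s f₁ f₂ = lap s f₁ f₂ - ∑ x, ∑ y, lap s f₁ (e x) * (G s)⁻¹ x y * lap s (e y) f₂)
    (hF : ∀ s x y, F s x y = s * cov (e x) (e y) - cov (e x) ((pinnedChain ω₂ lam β γ).generator N T T (e y)) -
      schur s (fun z => (pinnedChain ω₂ lam β γ).generator N T T (e x) (z.1, -z.2))
        ((pinnedChain ω₂ lam β γ).generator N T T (e y)))
    (hg : ∀ i z, g i z = (∑ b : Fin N, if b.val + 1 = i.val then (pinnedChain ω₂ lam β γ).bondCurrent N b z else 0) +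
      (∑ x : Fin N, if (i.val = 0 ∧ x.val = 0) ∨ (i.val = N ∧ x.val + 1 = N) then
        (pinnedChain ω₂ lam β γ).γ * (T - z.2 x ^ 2) else 0))
    (hW : ∀ s i j, W s i j = (if i = j ∧ (i.val = 0 ∨ i.val = N) then (pinnedChain ω₂ lam β γ).γ * T ^ 2 else 0) -
      schur s (fun z => g i (z.1, -z.2)) (g j))
    (hBv : ∀ ξ i, Bv ξ i = if i.val = N then (∑ x : Fin N, if x.val + 1 = N then ξ x else 0)
      else ∑ x : Fin N, ((if x.val = i.val then ξ x else 0) - (if x.val + 1 = i.val then ξ x else 0)))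
    (hRob : ∀ s : ℝ, 0 < s → s < s₁ → ∀ ξ : Fin N → ℝ,
      c * (∑ i : Fin N, ((∑ j : Fin N, if j.val = i.val + 1 then (ξ j - ξ i) ^ 2 else 0) +
        (if i.val = 0 then ξ i ^ 2 else 0) + (if i.val = N - 1 then ξ i ^ 2 else 0))) ≤
      ∑ x, ∑ y, ξ x * F s x y * ξ y)
    (u : ℕ → ℝ) (hu : ∑ k ∈ range M, u k = 0) :
    c * ∑ k ∈ range M, u k ^ 2 ≤
      (∑ k ∈ range M, ∑ l ∈ range M, u k * K ((k : ℤ) - l) * u l) + ε * (∑ k ∈ range M, |u k|) ^ 2 := by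
  have hb := hbulk lap e G schur g W hlap he hG hschur hg hW
  have hN1 : 1 ≤ N := by omega
  have hAM : R + 1 + M ≤ N + 1 := by omega
  -- the window vector, its profile, Lemma A
  set v : Fin (N + 1) → ℝ := fun i =>
    if R + 1 ≤ i.val ∧ i.val < R + 1 + M then u (i.val - (R + 1)) else 0 with hv_def
  have hv : ∀ i, v i = if R + 1 ≤ i.val ∧ i.val < R + 1 + M then u (i.val - (R + 1)) else 0 := fun i => rfl
  set ξ : Fin N → ℝ := fun x => ∑ k ∈ range (min (x.val + 1 - (R + 1)) M), u k with hξ_def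
  have hBvξ : ∀ i, Bv ξ i = v i := fun i =>
    Bv_profile Bv hBv hN1 (A := R + 1) (M := M) (by omega) (by omega) u hu i
  -- the static term is one fixed nonnegative number
  have hC0 : 0 ≤ ∑ x, ∑ y, ξ x * cov (e x) (e y) * ξ y :=
    (stub_blockForm ω₂ lam β γ hω hl hβ hγ T hT N hN lap cov e G schur F g W Bv hlap hcov he hG hschur hF hg hW
      hBv 1 one_pos).2.1 ξ
  -- re-indexing the window sums by `range M`
  have hsq : ∑ i, v i ^ 2 = ∑ k ∈ range M, u k ^ 2 := by
    set Usq : ℕ → ℝ := fun n => u (n - (R + 1)) ^ 2 with hUsq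
    have h1 : ∀ i : Fin (N + 1), v i ^ 2 = if R + 1 ≤ i.val ∧ i.val < R + 1 + M then Usq i.val else 0 := by
      intro i
      rw [hv]
      split_ifs <;> simp [hUsq]
    rw [Finset.sum_congr rfl fun i _ => h1 i, sum_window hAM Usq]
    simp only [hUsq, Nat.add_sub_cancel_left]
  have habs : ∑ i, |v i| = ∑ k ∈ range M, |u k| := by
    set Ua : ℕ → ℝ := fun n => |u (n - (R + 1))| with hUa
    have h1 : ∀ i : Fin (N + 1), |v i| = if R + 1 ≤ i.val ∧ i.val < R + 1 + M then Ua i.val else 0 := by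
      intro i
      rw [hv]
      split_ifs <;> simp [hUa]
    rw [Finset.sum_congr rfl fun i _ => h1 i, sum_window hAM Ua]
    simp only [hUa, Nat.add_sub_cancel_left]
  have hquad : ∑ i, ∑ j, v i * K ((i.val : ℤ) - j.val) * v j =
      ∑ k ∈ range M, ∑ l ∈ range M, u k * K ((k : ℤ) - l) * u l := by
    set Φ : ℕ → ℕ → ℝ := fun n m => u (n - (R + 1)) * K ((n : ℤ) - m) * u (m - (R + 1)) with hΦ
    have h1 : ∀ i j : Fin (N + 1), v i * K ((i.val : ℤ) - j.val) * v j =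
        (if R + 1 ≤ i.val ∧ i.val < R + 1 + M then (1 : ℝ) else 0) *
          (if R + 1 ≤ j.val ∧ j.val < R + 1 + M then (1 : ℝ) else 0) * Φ i.val j.val := by
      intro i j
      rw [hv, hv]
      split_ifs <;> simp [hΦ]
    rw [Finset.sum_congr rfl fun i _ => Finset.sum_congr rfl fun j _ => h1 i j, sum_sum_window hAM Φ]
    simp only [hΦ, Nat.add_sub_cancel_left]
    refine Finset.sum_congr rfl fun a _ => Finset.sum_congr rfl fun b _ => ?_
    have e1 : (((R + 1 + a : ℕ) : ℤ) - ((R + 1 + b : ℕ) : ℤ)) = (a : ℤ) - b := by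
      push_cast
      ring
    rw [e1]
  -- the estimate at every admissible `s`
  have key : ∀ s : ℝ, 0 < s → s < s₀ → s < s₁ →
      c * ∑ k ∈ range M, u k ^ 2 ≤ s * (∑ x, ∑ y, ξ x * cov (e x) (e y) * ξ y) +
        ((∑ k ∈ range M, ∑ l ∈ range M, u k * K ((k : ℤ) - l) * u l) + ε * (∑ k ∈ range M, |u k|) ^ 2) := by
    intro s hs hss₀ hss₁
    obtain ⟨-, -, hid, hrob⟩ := stub_blockForm ω₂ lam β γ hω hl hβ hγ T hT N hN lap cov e G schur F g W Bv
      hlap hcov he hG hschur hF hg hW hBv s hs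
    have h1 := hRob s hs hss₁ ξ
    rw [← hrob ξ, hid ξ] at h1
    simp only [hBvξ] at h1
    -- entrywise comparison with the Toeplitz matrix of `K` on the window
    have h2 : ∀ i j : Fin (N + 1), v i * W s i j * v j ≤
        v i * K ((i.val : ℤ) - j.val) * v j + ε * (|v i| * |v j|) := by
      intro i j
      by_cases hi : R + 1 ≤ i.val ∧ i.val < R + 1 + M
      · by_cases hj : R + 1 ≤ j.val ∧ j.val < R + 1 + M
        · have hij := hb s hs hss₀ i j hi.1 (by omega) hj.1 (by omega) (by omega) (by omega)
          have h3 : v i * v j * (W s i j - K ((i.val : ℤ) - j.val)) ≤ |v i| * |v j| * ε :=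
            calc v i * v j * (W s i j - K ((i.val : ℤ) - j.val))
                ≤ |v i * v j * (W s i j - K ((i.val : ℤ) - j.val))| := le_abs_self _
              _ = |v i| * |v j| * |W s i j - K ((i.val : ℤ) - j.val)| := by rw [abs_mul, abs_mul]
              _ ≤ |v i| * |v j| * ε := mul_le_mul_of_nonneg_left hij (by positivity)
          nlinarith [h3]
        · have hvj : v j = 0 := by rw [hv]; exact if_neg hj
          simp [hvj]
      · have hvi : v i = 0 := by rw [hv]; exact if_neg hi
        simp [hvi]
    have h3 : ∑ i, ∑ j, v i * W s i j * v j ≤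
        (∑ i, ∑ j, v i * K ((i.val : ℤ) - j.val) * v j) + ∑ i, ∑ j, ε * (|v i| * |v j|) := by
      rw [← Finset.sum_add_distrib]
      refine Finset.sum_le_sum fun i _ => ?_
      rw [← Finset.sum_add_distrib]
      exact Finset.sum_le_sum fun j _ => h2 i j
    have h4 : ∑ i, ∑ j, ε * (|v i| * |v j|) = ε * (∑ k ∈ range M, |u k|) ^ 2 := by
      rw [← habs, pow_two, Finset.sum_mul_sum, Finset.mul_sum]
      refine Finset.sum_congr rfl fun i _ => ?_
      rw [Finset.mul_sum]
    rw [hsq] at h1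
    rw [hquad, h4] at h3
    linarith
  -- let `s ↓ 0`: the static term disappears
  generalize hCq : (∑ x, ∑ y, ξ x * cov (e x) (e y) * ξ y) = Cq at hC0 key
  refine le_of_forall_pos_le_add fun δ hδ => ?_
  have hC1 : 0 < Cq + 1 := by linarith
  have hm : 0 < min s₀ s₁ := lt_min hs₀ hs₁
  set s : ℝ := min (min s₀ s₁ / 2) (δ / (Cq + 1)) with hs_def
  have hs : 0 < s := lt_min (half_pos hm) (div_pos hδ hC1)
  have hss₀ : s < s₀ := lt_of_le_of_lt (min_le_left _ _) (by linarith [min_le_left s₀ s₁])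
  have hss₁ : s < s₁ := lt_of_le_of_lt (min_le_left _ _) (by linarith [min_le_right s₀ s₁])
  have hsC : s * Cq ≤ δ :=
    calc s * Cq ≤ δ / (Cq + 1) * Cq := mul_le_mul_of_nonneg_right (min_le_right _ _) hC0
      _ ≤ δ / (Cq + 1) * (Cq + 1) := mul_le_mul_of_nonneg_left (by linarith) (div_pos hδ hC1).le
      _ = δ := div_mul_cancel₀ δ hC1.ne'
  have := key s hs hss₀ hss₁
  linarith

/-! ### The necessity link -/

/-- **The crux bounds the symbol of every bulk limit from below** (registered necessity link of line
`limit-operator-memory-form`, crux `RobinCoercivity`, stmt-AtomisticToContinuum-12695). If `RobinCoercivity` holds,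
then for `pinnedChain ω₂ lam β γ` (all `> 0`) and `T > 0` there is `c > 0` (the crux's constant) such that every
summable `K : ℤ → ℝ` which is a bulk Toeplitz limit of the block memory matrix `W_N(s)` — entrywise at every fixed
mutual distance `≤ Z`, uniformly over the bulk positions at depth `R(ε, Z)`, for all `N ≥ 2` and `0 < s < s₀(N)`
(verbatim the hypothesis of the registered stub `stub_symbolPositivity`, rev 2) — has `Σ'_z K(z)cos(zθ) ≥ c` at
every `θ`. In particular, given the bulk-limit property (L), strict positivity of the bulk symbol (Q1) is NECESSARY
for the crux. -/
theorem symbol_ge_of_robinCoercivity (hRC : RobinCoercivity) : ∀ ω₂ lam β γ : ℝ, 0 < ω₂ → 0 < lam → 0 < β → 0 < γ →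
    ∀ T : ℝ, 0 < T → ∃ c : ℝ, 0 < c ∧ ∀ K : ℤ → ℝ, Summable K →
    (∀ ε : ℝ, 0 < ε → ∀ Z : ℕ, ∃ R : ℕ, ∀ N : ℕ, 2 ≤ N → ∃ s₀ : ℝ, 0 < s₀ ∧
    ∀ (lap : ℝ → (PhaseSpace N → ℝ) → (PhaseSpace N → ℝ) → ℝ) (e : Fin N → PhaseSpace N → ℝ)
      (G : ℝ → Matrix (Fin N) (Fin N) ℝ) (schur : ℝ → (PhaseSpace N → ℝ) → (PhaseSpace N → ℝ) → ℝ)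
      (g : Fin (N + 1) → PhaseSpace N → ℝ) (W : ℝ → Fin (N + 1) → Fin (N + 1) → ℝ),
    (∀ s f₁ f₂, lap s f₁ f₂ = ∫ t in Set.Ioi (0 : ℝ), Real.exp (-(s * t)) *
      ((∫ z, f₁ z * (∫ y, f₂ y ∂((pinnedChain ω₂ lam β γ).transitionKernel N T T t.toNNReal z))
        ∂(pinnedChain ω₂ lam β γ).gibbsMeasure N T) -
        (∫ z, f₁ z ∂(pinnedChain ω₂ lam β γ).gibbsMeasure N T) *
          (∫ z, f₂ z ∂(pinnedChain ω₂ lam β γ).gibbsMeasure N T))) →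
    (∀ x z, e x z = z.2 x ^ 2 / 2 + (pinnedChain ω₂ lam β γ).U (z.1 x) +
      ∑ j : Fin N, ((if j.val = x.val + 1 then (pinnedChain ω₂ lam β γ).V (z.1 j - z.1 x) / 2 else 0) +
        (if x.val = j.val + 1 then (pinnedChain ω₂ lam β γ).V (z.1 x - z.1 j) / 2 else 0))) →
    (∀ s, G s = Matrix.of fun x y => lap s (e x) (e y)) →
    (∀ s f₁ f₂, schur s f₁ f₂ = lap s f₁ f₂ - ∑ x, ∑ y, lap s f₁ (e x) * (G s)⁻¹ x y * lap s (e y) f₂) →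
    (∀ i z, g i z = (∑ b : Fin N, if b.val + 1 = i.val then (pinnedChain ω₂ lam β γ).bondCurrent N b z else 0) +
      (∑ x : Fin N, if (i.val = 0 ∧ x.val = 0) ∨ (i.val = N ∧ x.val + 1 = N) then
        (pinnedChain ω₂ lam β γ).γ * (T - z.2 x ^ 2) else 0)) →
    (∀ s i j, W s i j = (if i = j ∧ (i.val = 0 ∨ i.val = N) then (pinnedChain ω₂ lam β γ).γ * T ^ 2 else 0) -
      schur s (fun z => g i (z.1, -z.2)) (g j)) →
    ∀ s : ℝ, 0 < s → s < s₀ → ∀ i j : Fin (N + 1), R + 1 ≤ i.val → i.val + 1 + R ≤ N → R + 1 ≤ j.val →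
      j.val + 1 + R ≤ N → i.val ≤ j.val + Z → j.val ≤ i.val + Z → |W s i j - K ((i.val : ℤ) - j.val)| ≤ ε) →
    ∀ θ : ℝ, c ≤ ∑' z : ℤ, K z * Real.cos (z * θ) := by
  intro ω₂ lam β γ hω hl hβ hγ T hT
  obtain ⟨c, hc, hcN⟩ := hRC ω₂ lam β γ hω hl hβ hγ T hT
  refine ⟨c, hc, ?_⟩
  intro K hK hL θ
  refine symbol_ge_of_meanZero_coercive K hK c (fun M u hu => ?_) θ
  refine le_of_forall_pos_le_add fun η hη => ?_
  have hS1 : 0 < (∑ k ∈ Finset.range M, |u k|) ^ 2 + 1 := by positivity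
  obtain ⟨R, hR⟩ := hL (η / ((∑ k ∈ Finset.range M, |u k|) ^ 2 + 1)) (by positivity) M
  have hN2 : 2 ≤ 2 * R + 2 + M := by omega
  obtain ⟨s₀, hs₀, hNs⟩ := hR (2 * R + 2 + M) hN2
  obtain ⟨s₁, hs₁, hRob⟩ := hcN (2 * R + 2 + M) hN2
  dsimp only at hRob
  have key := window_fixedN hω hl hβ hγ hT hN2 K c (η / ((∑ k ∈ Finset.range M, |u k|) ^ 2 + 1)) s₀ s₁ hs₀ hs₁
    R M M le_rfl le_rfl hNs _ _ _ _ _ _ _ _ _ (fun _ _ _ => rfl) (fun _ _ => rfl) (fun _ _ => rfl) (fun _ => rfl)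
    (fun _ _ _ => rfl) (fun _ _ _ => rfl) (fun _ _ => rfl) (fun _ _ _ => rfl) (fun _ _ => rfl) hRob u hu
  have hfrac : η / ((∑ k ∈ Finset.range M, |u k|) ^ 2 + 1) * (∑ k ∈ Finset.range M, |u k|) ^ 2 ≤ η := by
    rw [div_mul_eq_mul_div, div_le_iff₀ hS1]
    nlinarith
  linarith

end Summit.AtomisticToContinuum.FouriersLaw.Theorems.HonestZwanzig.Robin

end
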